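import Summits.ResolutionOfSingularities.ResolutionOfSingularities.Theorems.UniversalCellsCampaignW82FrobeniusTwistGraded
import HarnessLib

/-!
# [OURS · L1 W8.2] The residual of slot W8.2 with the Frobenius exponent PINNED TO ZERO — campaign
# statements, Theses-free module (rung B, prime-field / family transfer)

Cell `res-hironaka` (run/shared/lean/pub/res-hironaka/), LADDER-RESOLUTION rung L (RESCUE), slot W8.2 of
plan/RESCUE-SEED.md («PRIME-FIELD / UNIVERSALITY TRANSFER instead of descent»), host route `UniversalCells`, host
item `PrimeFieldToPerfect` (stmt-ResolutionOfSingularities-15233); second door `UniformComplexity`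
`PrimeModelTransfer` (stmt-ResolutionOfSingularities-8933). Statement-only file (written by the slot's prover
res-L1-s82-pv-1, gen 3, for the two-lane desk; the proofs AGAINST these names are in the sibling file
Theorems/UniversalCellsCampaignW82ExponentZeroProofs.lean): one parametric predicate, one graded OURS `Prop`,
two pure-logic anchors; NOTHING is proved about resolution of singularities here and nothing is asserted.

WHY THIS FILE. After gen 0–2 of this seat the residual of slot W8.2 is kernel-certified in four equivalent normal
forms (Theorems/UniversalCellsCampaignW82RegularFormProofs.lean `residual_normalForms_tfae`:
`PerfectionStepAt M n ↔ SmoothTwistStepAt M n ↔ FrobeniusTwistStepAt p M n ↔ FrobeniusTwistStepRegularAt p M n`),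
the sharpest being: «given resolution in dimension `≤ n` over `M(t)`, SOME Frobenius twist
`X₀ ×_{M(t),Frob^e} M(t)` of every REGULAR irreducible geometrically reduced `X₀` of dimension `≤ n` over `M(t)`
has a proper birational model SMOOTH over `M(t)`» (`CampaignW82.FrobeniusTwistStepRegularAt`,
`CampaignW82.HasSmoothFrobeniusTwistModel`: `∃ e, …`). The crux documents single out the strengthening
«`e = 0` suffices» as the first thing a proof may NOT do (Cruxes/PrimeFieldToPerfect/KERNEL.md §4 (s1);
Cruxes/PrimeFieldToPerfect/Disproof.lean §3, near-miss `not_smoothTwist_levelZero`, sorried since 2026-08-17 for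
want of «a proper birational morphism onto a regular curve is an isomorphism»). This file NAMES that
strengthening so that the sibling proofs file can REFUTE it by name at the first grade `n = 1` (where the
genuine step is a theorem: `frobeniusTwistStepRegularAt_of_le_one`), i.e. certify that the existential over the
Frobenius exponent in the residual's normal form is load-bearing from dimension one on.

CONTENT (non-embedded summit idiom `Scheme.HasResolution` / `IsBirational` / `Scheme.IsRegular`, ground field
passed explicitly as `f₀ : X₀ ⟶ Spec K`, Mathlib `Smooth`, `IsProper`; dimension = `topologicalKrullDim` of the
carrier in `WithBot ℕ∞` as in the graded kernel):

* `HasSmoothProperBirationalModel K f₀` — a proper birational `π : Y ⟶ X₀` with `Y ⟶ Spec K` SMOOTH: the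
  conclusion predicate `HasSmoothFrobeniusTwistModel p K f₀` with the exponent pinned to `e = 0`, equivalently
  `HasSmoothModelAtFiniteLevel K f₀` with the level pinned to `K' = K` (sibling proofs:
  `hasSmoothFrobeniusTwistModel_of_hasSmoothProperBirationalModel`,
  `hasSmoothModelAtFiniteLevel_of_hasSmoothProperBirationalModel`).
* `SmoothModelStepRegularAt M n` — `FrobeniusTwistStepRegularAt p M n` with its conclusion so pinned: «given
  resolution in dimension `≤ n` over `RatFunc M`, every separated `X₀` of finite type over `RatFunc M` of
  dimension `≤ n`, integral over the perfect closure and REGULAR, has a proper birational model smooth over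
  `RatFunc M` itself». Over ANY field `M` (no characteristic is mentioned: the twist is gone).
* anchors (pure logic, `Iff.rfl`): `hasSmoothProperBirationalModel_iff`, `smoothModelStepRegularAt_iff`.

THEOREMS-TO-PROVE (names fixed here, proofs in the sibling file): `not_smoothModelStepRegularAt_zmod_one` —
`¬ SmoothModelStepRegularAt (ZMod p) 1` for every prime `p` (witness: Kollár's regular, geometrically integral,
non-smooth affine curve `y^{p+1} = x^p − t` over `𝔽_p(t)`; a smooth proper birational model would be isomorphic
to it by Zariski's uniqueness of regular models of curves, tree
`Resolution.exists_isIso_morphismRestrict_of_ringKrullDim_le_one`, and base-change to a regular scheme over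
`𝔽_p(t^{1/p})`, contradicting the barrier decl `Literature.Barriers.ResolutionOfSingularities.not_isRegularLocalRing_cuspIdeal`);
`frobeniusTwistStepRegularAt_of_smoothModelStepRegularAt` (the pinned form implies the genuine one); and the
juxtaposition `frobeniusTwistStepRegularAt_one_and_not_smoothModelStepRegularAt_one`.

HONEST FRAMING. The `def`s below are OURS — campaign statements that REPLACE THE ROLE of a printed item of
H. Hironaka's manuscript *Resolution of singularities in positive characteristics* (2017-03-23, [Hironaka2017],
lit key `paper:url-3343fd9e678b`) — namely §17 ¶2, p.89 l.59–62 («In this work the base field K is always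
assumed to be a finite field or Z/pZ because our resolution is for all dimension. When the K has
transcendence degree d we can reformulate the resolution problem to the case of dimension d + dim Z.», typed
AS PRINTED as `Literature.AlgebraicGeometry.Hironaka2017.S17Methodology.U89_3`, and under the §2 p.4 l.22–24
reading «a perfect base field K» as `U89_3_ours`; quotes and locators as in the lane-signed siblings p469608 /
p483512) at transcendence degree one: the printed reformulation resolves a model over `𝔽_p` and RESTRICTS to
the generic fibre, which yields a REGULAR variety over `𝔽_p(t)` — `SmoothModelStepRegularAt` is the precise
statement that this regular variety could be made SMOOTH without twisting, and it is FALSE (sibling file). NOT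
statements of the manuscript; nothing here is attributed to its author; no typed candidate of the manuscript
is used even as a hypothesis. AI transcription, weaker than expert review.

BUILD RULE (cell, director-resolution 2026-08-26T18:53:29Z (B)): OURS vocabulary file, THESES-FREE BY BIRTH —
imports only the Theses-free module Theorems/UniversalCellsCampaignW82FrobeniusTwistGraded.lean (p483512 → v2
p485672; cone: p481193, p469608, p475047) and `HarnessLib`.

BARRIERS (catalogued under `Literature/Barriers/ResolutionOfSingularities/`): `SmoothModelStepRegularAt M n`
does not evade but RUNS INTO file `RegularNotGeometricallyRegular.lean` (Kollár 2007, 1.19: regular is not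
geometrically regular) — that is the point: the sibling file turns the barrier's local computation
(`isRegularLocalRing_kollarPoint`, `not_isRegularLocalRing_cuspIdeal`) into the global negation of this `Prop`.
Files `FrobeniusTwistResolution.lean` / `InseparableBaseChangeResolution.lean` (no transport of resolutions
along `K → K^{1/p}`) are not engaged (nothing is transported).

VACUITY SELF-CHECK (one line per decl in the docstrings): `HasSmoothProperBirationalModel K f₀` is true when
`f₀` is smooth (`Y = X₀`, `π = 𝟙`), false for `X₀ = Spec 𝔽_p(t^{1/p})` over `𝔽_p(t)` (it implies
`HasSmoothModelAtFiniteLevel`, refuted there by `no_smoothModel_inseparablePoint`) and — the content of the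
sibling file — false for Kollár's regular curve; `SmoothModelStepRegularAt M n` is trivially true at `n = ⊥`
and (both sides) in characteristic `0` where regular = smooth (not intended); for `M` of characteristic `p` it
is NOT implied by `ResolutionInChar p` (unlike the four genuine normal forms) and is FALSE at `M = ZMod p`,
`n = 1` (sibling file) — never vacuous there: its hypothesis (resolution of curves over `𝔽_p(t)`) is a theorem
(`Resolution.hasResolution_of_dim_le_one`).

## References (vocabulary and locators only; nothing cited as a premise)
* H. Hironaka, ms. 2017-03-23, §17 ¶2 p.89 l.59–62; §2 p.4 l.22–24 — under adjudication, quoted for the role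
  replaced, not asserted. [Hironaka2017]
* J. Kollár, *Lectures on Resolution of Singularities* (2007), 1.19 (curves over nonperfect fields) — the
  witness behind the sibling refutation, via the barrier catalogue. [Kollar2007]
* Q. Liu, *Algebraic Geometry and Arithmetic Curves* (2002), Ex. 7.3.15, Rem. 4.3.34, Cor. 4.4.3. [Liu2002]
* Cruxes/PrimeFieldToPerfect/KERNEL.md §4 (s1); Cruxes/PrimeFieldToPerfect/Disproof.lean §3
  (`not_smoothTwist_levelZero`, near-miss); L/res-L1-s82-pv-1/NOTES.md gen 2 «Not done (s1)» — cell files, OURS.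
-/

noncomputable section

set_option linter.dupNamespace false -- mandated namespace of this single-conjunct summit

open _root_.CategoryTheory _root_.CategoryTheory.Limits _root_.AlgebraicGeometry
open Literature.AlgebraicGeometry.Resolution

namespace Summit.ResolutionOfSingularities.ResolutionOfSingularities.Theorems.CampaignW82

universe u

/-! ## A smooth proper birational model over the ground field itself (exponent `e = 0`, level `K' = K`) -/

/-- [OURS · L1 W8.2] replaces the role of §17 ¶2, p.89 l.59–62 read with §2 p.4 l.22–24 («a perfect base field
K»; typed as `S17Methodology.U89_3_ours`) by naming what the printed «reformulate over the finite level and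
restrict» would have to deliver WITHOUT any Frobenius twist; NOT a statement of the manuscript. A SMOOTH PROPER
BIRATIONAL MODEL OVER `K` ITSELF: for a field `K` and `f₀ : X₀ ⟶ Spec K` there are a scheme `Y` and a proper
birational `π : Y ⟶ X₀` (`IsProper`, tree `IsBirational`) whose composite with `f₀` is `Smooth`. This is
`HasSmoothFrobeniusTwistModel p K f₀` with the exponent pinned to `e = 0` and `HasSmoothModelAtFiniteLevel K f₀`
with the level pinned to `K' = K` (sibling proofs file: it implies both). Vacuity: true whenever `f₀` is smooth
(`Y = X₀`, `π = 𝟙`); false for `X₀ = Spec 𝔽_p(t^{1/p})` over `𝔽_p(t)` (through `HasSmoothModelAtFiniteLevel` and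
`Theorems.PrimeFieldToPerfect.Negative.no_smoothModel_inseparablePoint`); false — sibling file
`kollarCurve_not_hasSmoothProperBirationalModel` — for Kollár's REGULAR, geometrically integral curve
`y^{p+1} = x^p − t` over `𝔽_p(t)`, although some Frobenius twist of it does have a smooth model
(`hasSmoothFrobeniusTwistModel_of_dim_le_one`). [folklore] -/
def HasSmoothProperBirationalModel (K : Type u) [Field K] {X₀ : Scheme.{u}} (f₀ : X₀ ⟶ Spec (.of K)) :
    Prop :=
  ∃ (Y : Scheme.{u}) (π : Y ⟶ X₀), IsProper π ∧ IsBirational π ∧ Smooth (π ≫ f₀)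

/-! ## The residual's regular normal form with the exponent pinned to zero -/

/-- [OURS · L1 W8.2] replaces the role of §17 ¶2, p.89 l.59–62 («When the K has transcendence degree d we can
reformulate the resolution problem to the case of dimension d + dim Z») read with §2 p.4 l.22–24 («a perfect
base field K»; typed as `S17Methodology.U89_3_ours`) at transcendence degree one, OVER THE SINGLE FIELD
`RatFunc M`, for REGULAR varieties, WITH THE FROBENIUS EXPONENT PINNED TO ZERO; NOT a statement of the
manuscript. THE SMOOTH-MODEL STEP FOR REGULAR VARIETIES at `M`, grade `n`: if every integral separated scheme
of finite type of dimension `≤ n` over `RatFunc M` has a resolution (hypothesis block of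
`CampaignW82.PerfectionStepAt M n`, verbatim), then every separated `f₀ : X₀ ⟶ Spec (RatFunc M)` of finite
type with `topologicalKrullDim X₀ ≤ n`, `IntegralOverPerfectClosure (RatFunc M) f₀` (irreducible and
geometrically reduced) and `X₀` REGULAR has `HasSmoothProperBirationalModel (RatFunc M) f₀` — a proper
birational model smooth over `RatFunc M` ITSELF. This is `CampaignW82.FrobeniusTwistStepRegularAt p M n`
(p485672; one of the four kernel-certified normal forms of the residual of slot W8.2,
`residual_normalForms_tfae`) with `∃ e` replaced by `e = 0`; it implies that form
(`frobeniusTwistStepRegularAt_of_smoothModelStepRegularAt`, sibling file) and is strictly stronger: the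
sibling file proves `¬ SmoothModelStepRegularAt (ZMod p) 1` for every prime `p`
(`not_smoothModelStepRegularAt_zmod_one`), whereas `FrobeniusTwistStepRegularAt p M 1` holds for every `M`
(`frobeniusTwistStepRegularAt_of_le_one`). So the existential over the exponent in the residual is
load-bearing from dimension `1` on, as the crux documents predicted (Cruxes/PrimeFieldToPerfect/KERNEL.md §4
(s1)). Stated over ANY field `M` (no twist, so no characteristic is needed). Vacuity: trivially true exactly at
`n = ⊥`; in characteristic `0` both sides hold (regular of finite type = smooth; not intended); for `M` of
characteristic `p` it is NOT a consequence of `ResolutionInChar p` and it is false at `(ZMod p, 1)` with a TRUE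
hypothesis (resolution of curves over `𝔽_p(t)` is the tree theorem `Resolution.hasResolution_of_dim_le_one`) —
so the negation is informative, not vacuous; NOT monotone in `n`. [folklore] -/
def SmoothModelStepRegularAt (M : Type) [Field M] (n : WithBot ℕ∞) : Prop :=
  (∀ (X : Scheme.{0}) (f : X ⟶ Spec (.of (RatFunc M))),
      IsSeparated f → LocallyOfFiniteType f → QuasiCompact f → IsIntegral X →
        topologicalKrullDim X ≤ n → Scheme.HasResolution X) →
    ∀ (X₀ : Scheme.{0}) (f₀ : X₀ ⟶ Spec (.of (RatFunc M))),
      IsSeparated f₀ → LocallyOfFiniteType f₀ → QuasiCompact f₀ → topologicalKrullDim X₀ ≤ n →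
        IntegralOverPerfectClosure (RatFunc M) f₀ → Scheme.IsRegular X₀ →
          HasSmoothProperBirationalModel (RatFunc M) f₀

/-! ## Pure-logic anchors -/

/-- **The predicate, inlined** (definitional, `Iff.rfl`). [folklore] -/
theorem hasSmoothProperBirationalModel_iff (K : Type u) [Field K] {X₀ : Scheme.{u}}
    (f₀ : X₀ ⟶ Spec (.of K)) :
    HasSmoothProperBirationalModel K f₀ ↔
      ∃ (Y : Scheme.{u}) (π : Y ⟶ X₀), IsProper π ∧ IsBirational π ∧ Smooth (π ≫ f₀) :=
  Iff.rfl

/-- **The pinned step, inlined** (definitional, `Iff.rfl`): the hypothesis block is that of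
`FrobeniusTwistStepRegularAt p M n` verbatim and the conclusion is `HasSmoothProperBirationalModel` in place of
`HasSmoothFrobeniusTwistModel p`. [folklore] -/
theorem smoothModelStepRegularAt_iff (M : Type) [Field M] (n : WithBot ℕ∞) :
    SmoothModelStepRegularAt M n ↔
      ((∀ (X : Scheme.{0}) (f : X ⟶ Spec (.of (RatFunc M))),
          IsSeparated f → LocallyOfFiniteType f → QuasiCompact f → IsIntegral X →
            topologicalKrullDim X ≤ n → Scheme.HasResolution X) →
        ∀ (X₀ : Scheme.{0}) (f₀ : X₀ ⟶ Spec (.of (RatFunc M))),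
          IsSeparated f₀ → LocallyOfFiniteType f₀ → QuasiCompact f₀ → topologicalKrullDim X₀ ≤ n →
            IntegralOverPerfectClosure (RatFunc M) f₀ → Scheme.IsRegular X₀ →
              HasSmoothProperBirationalModel (RatFunc M) f₀) :=
  Iff.rfl

end Summit.ResolutionOfSingularities.ResolutionOfSingularities.Theorems.CampaignW82

end
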